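import Literature.Probability.LatticeModels.CoarseCellMixingCounting
import Literature.Probability.LatticeModels.CoarseCellMixingDLR
import HarnessLib

/-!
# Peierls rarity of bad cells: transfer from reference kernels to a perturbed specification

Eighth companion file of `Literature/Probability/LatticeModels/CoarseCellFiniteSize.lean`.
Disagreement percolation with rare defects (van den Berg–Maes 1994) needs the bad cells of the
finite-size condition `IsGoodFS` to be Peierls-rare under the measure being expanded. For a
perturbed specification `γ` that is only locally absolutely continuous w.r.t. a reference `γ₀`
(`IsLocallyAC cell γ γ₀ ε₁`: the comparison on a volume `A` costs `e^{ε₁·cellCount A}`), rarity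
can be transferred volume-locally from a Peierls bound for the REFERENCE KERNELS that is uniform in
the volume and in the boundary condition away from boundary defects:

* `UniformKernelPeierls cell γ₀ good p` — for every cell-union `A`, exterior `ζ` and cell set `D`
  whose `cdist ≤ 1` neighbours are each entirely resampled or good in `ζ`,
  `γ₀,A(all cells of D bad | ζ) ≤ p^{|D|}` (a NAMED HYPOTHESIS, not a theorem: it is the form in
  which a Peierls / chessboard estimate for the reference system has to be supplied);
* `kernel_allBad_le_of_uniformKernelPeierls` — then the PERTURBED kernels satisfy the same bound
  at level `e^{3^d ε₁} p`, for every volume `Λ` and every exterior good next to `D`;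
* `peierlsRare_of_uniformKernelPeierls` — in particular every Gibbs measure of `γ` on a finite
  site set has `PeierlsRare good ν (e^{3^d ε₁} p)`.

## References

* J. van den Berg, C. Maes, *Disagreement percolation in the study of Markov fields*,
  Ann. Probab. 22 (1994), §2.
* H.-O. Georgii, *Gibbs Measures and Phase Transitions*, 2nd ed. (de Gruyter 2011), Ch. 8 and
  §6.2 (Peierls' estimate).
-/

noncomputable section

open _root_.MeasureTheory
open scoped ENNReal

namespace Literature.Probability.LatticeModels

variable {d : ℕ} {μc : Fin d → ℕ} {V S : Type*} [MeasurableSpace S]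

/-- **Uniform Peierls bound for the kernels of a specification**: for every cell-union volume
`A`, every boundary condition `ζ` and every finite set of cells `D` such that each cell within
`cdist ≤ 1` of `D` is either entirely resampled (all its sites in `A`) or good in `ζ`, the kernel
probability that ALL cells of `D` are bad is `≤ p^{|D|}` (Peierls condition for contours /
large-field regions, uniformly in volume and boundary condition away from boundary defects).
[cite: Georgii2011, §6.2] -/
def UniformKernelPeierls [Fintype V] (cell : V → CoarseIdx μc) (γ : Specification V S)
    (good : CoarseIdx μc → Set (V → S)) (p : ℝ) : Prop :=
  ∀ (A : Finset V), (∀ v w, cell v = cell w → v ∈ A → w ∈ A) →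
    ∀ (ζ : V → S) (D : Finset (CoarseIdx μc)),
      (∀ c ∈ D, ∀ c' : CoarseIdx μc, cdist c c' ≤ 1 → (∀ v, cell v = c' → v ∈ A) ∨ ζ ∈ good c') →
      γ A ζ {σ | ∀ c ∈ D, σ ∉ good c} ≤ ENNReal.ofReal (p ^ D.card)

omit [MeasurableSpace S] in
/-- The all-bad event of a finite cell set is measurable. [folklore] -/
theorem measurableSet_allBad [MeasurableSpace (V → S)] {good : CoarseIdx μc → Set (V → S)}
    (hgm : ∀ c, MeasurableSet (good c)) (D : Finset (CoarseIdx μc)) :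
    MeasurableSet {σ : V → S | ∀ c ∈ D, σ ∉ good c} := by
  have h : {σ : V → S | ∀ c ∈ D, σ ∉ good c} = ⋂ c ∈ D, (good c)ᶜ := by
    ext σ; simp
  rw [h]
  exact Finset.measurableSet_biInter D fun c _ => (hgm c).compl

/-- The `cdist ≤ 1` neighbourhood of `|D|` cells meets at most `3^d |D|` cells. [folklore] -/
theorem cellCount_neighbourhood_le [Fintype V] (cell : V → CoarseIdx μc) (Λ : Finset V)
    (D : Finset (CoarseIdx μc)) :
    (cellCount cell (Λ.filter fun v => ∃ c ∈ D, cdist c (cell v) ≤ 1) : ℝ) ≤ 3 ^ d * D.card := by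
  classical
  have h1 : cellCount cell (Λ.filter fun v => ∃ c ∈ D, cdist c (cell v) ≤ 1) ≤
      (D.biUnion fun c => Finset.univ.filter fun c' : CoarseIdx μc => cdist c c' ≤ 1).card := by
    unfold cellCount
    refine Finset.card_le_card fun c' hc' => ?_
    rw [Finset.mem_filter] at hc'
    obtain ⟨v, hv, hvc⟩ := hc'.2
    obtain ⟨c, hc, hcv⟩ := (Finset.mem_filter.1 hv).2
    rw [Finset.mem_biUnion]
    exact ⟨c, hc, Finset.mem_filter.2 ⟨Finset.mem_univ _, hvc ▸ hcv⟩⟩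
  have h2 : (D.biUnion fun c => Finset.univ.filter fun c' : CoarseIdx μc => cdist c c' ≤ 1).card
      ≤ D.card * 3 ^ d := by
    refine Finset.card_biUnion_le.trans ?_
    calc ∑ c ∈ D, (Finset.univ.filter fun c' : CoarseIdx μc => cdist c c' ≤ 1).card
        ≤ ∑ _c ∈ D, 3 ^ d := Finset.sum_le_sum fun c _ => by
          have h := card_filter_cdist_le c 1
          norm_num at h ⊢
          exact h
      _ = D.card * 3 ^ d := by rw [Finset.sum_const, smul_eq_mul]
  have h3 : (cellCount cell (Λ.filter fun v => ∃ c ∈ D, cdist c (cell v) ≤ 1) : ℝ) ≤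
      ((D.card * 3 ^ d : ℕ) : ℝ) := by exact_mod_cast h1.trans h2
  push_cast at h3
  linarith

/-- **Uniform Peierls bound for the perturbed kernels.** If `γ₀` satisfies
`UniformKernelPeierls cell γ₀ good p`, `good` is cell-local and measurable, and `γ` is a
specification locally absolutely continuous w.r.t. `γ₀` at rate `ε₁ ≥ 0` per cell, then for every
cell-union volume `Λ`, every exterior `ζ` and every cell set `D` whose `cdist ≤ 1` neighbours are
each a cell of `Λ` or good in `ζ`, `γ_Λ(all of D bad | ζ) ≤ (e^{3^d ε₁} p)^{|D|}`: resample the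
neighbourhood `A = Λ ∩ N₁(D)` inside `γ_Λ` (consistency), compare `γ_A ≤ e^{ε₁·cellCount A} γ₀,A`
(`cellCount A ≤ 3^d |D|`), and apply the reference bound to `γ₀,A` with the `γ_Λ(· | ζ)`-typical
exterior, which is good on the neighbours of `D` off `Λ` by properness and cell-locality.
[folklore] -/
theorem kernel_allBad_le_of_uniformKernelPeierls [Fintype V] {cell : V → CoarseIdx μc}
    {γ γ₀ : Specification V S} (hγ : IsSpecification γ) {good : CoarseIdx μc → Set (V → S)}
    (hgl : ∀ (c : CoarseIdx μc) (σ τ : V → S), (∀ v, cell v = c → σ v = τ v) →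
      (σ ∈ good c ↔ τ ∈ good c))
    (hgm : ∀ c, MeasurableSet (good c)) {p ε₁ : ℝ} (hp : 0 ≤ p) (hε₁ : 0 ≤ ε₁)
    (hUKP : UniformKernelPeierls cell γ₀ good p) (hAC : IsLocallyAC cell γ γ₀ ε₁)
    (Λ : Finset V) (hΛ : ∀ v w, cell v = cell w → v ∈ Λ → w ∈ Λ) (ζ : V → S)
    (D : Finset (CoarseIdx μc))
    (hD : ∀ c ∈ D, ∀ c' : CoarseIdx μc, cdist c c' ≤ 1 → (∀ v, cell v = c' → v ∈ Λ) ∨ ζ ∈ good c') :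
    γ Λ ζ {σ | ∀ c ∈ D, σ ∉ good c} ≤
      ENNReal.ofReal ((Real.exp (ε₁ * 3 ^ d) * p) ^ D.card) := by
  classical
  set E : Set (V → S) := {σ | ∀ c ∈ D, σ ∉ good c} with hEdef
  have hE : MeasurableSet E := measurableSet_allBad hgm D
  set A : Finset V := Λ.filter fun v => ∃ c ∈ D, cdist c (cell v) ≤ 1 with hA
  have hAΛ : A ⊆ Λ := Finset.filter_subset _ _
  have hAunion : ∀ v w, cell v = cell w → v ∈ A → w ∈ A := fun v w hvw hv => by
    rw [hA, Finset.mem_filter] at hv ⊢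
    exact ⟨hΛ v w hvw hv.1, hvw ▸ hv.2⟩
  have hcount : (cellCount cell A : ℝ) ≤ 3 ^ d * D.card := cellCount_neighbourhood_le cell Λ D
  -- the neighbour condition for the block kernel, for exteriors equal to `ζ` off `Λ`
  have hnbr : ∀ σ : V → S, (∀ v, v ∉ Λ → σ v = ζ v) → ∀ c ∈ D, ∀ c' : CoarseIdx μc,
      cdist c c' ≤ 1 → (∀ v, cell v = c' → v ∈ A) ∨ σ ∈ good c' := by
    intro σ hσ c hc c' hcc'
    by_cases hin : ∀ v, cell v = c' → v ∈ Λ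
    · exact Or.inl fun v hv => Finset.mem_filter.2 ⟨hin v hv, c, hc, hv ▸ hcc'⟩
    · push Not at hin
      obtain ⟨v₀, hv₀, hv₀Λ⟩ := hin
      have hout : ∀ v, cell v = c' → v ∉ Λ := fun v hv hvΛ =>
        hv₀Λ (hΛ v v₀ (hv.trans hv₀.symm) hvΛ)
      rcases hD c hc c' hcc' with h | h
      · exact absurd (h v₀ hv₀) hv₀Λ
      · exact Or.inr ((hgl c' σ ζ fun v hv => hσ v (hout v hv)).2 h)
  -- pointwise bound on the perturbed block kernel
  have hpt : ∀ σ : V → S, (∀ v, v ∉ Λ → σ v = ζ v) →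
      γ A σ E ≤ ENNReal.ofReal ((Real.exp (ε₁ * 3 ^ d) * p) ^ D.card) := by
    intro σ hσ
    haveI := hγ.isProbability A σ
    have hind : Measurable (E.indicator (1 : (V → S) → ℝ)) := measurable_const.indicator hE
    have hind01 : ∀ τ, 0 ≤ E.indicator (1 : (V → S) → ℝ) τ ∧
        E.indicator (1 : (V → S) → ℝ) τ ≤ 1 := fun τ => by by_cases h : τ ∈ E <;> simp [h]
    obtain ⟨hac, -⟩ := hAC A hAunion σ (E.indicator 1) hind hind01
    rw [integral_indicator_one hE, integral_indicator_one hE] at hac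
    have h0 : (γ₀ A σ).real E ≤ p ^ D.card :=
      ENNReal.toReal_le_of_le_ofReal (by positivity) (hUKP A hAunion σ D (hnbr σ hσ))
    have hexp : Real.exp (ε₁ * cellCount cell A) ≤ Real.exp (ε₁ * 3 ^ d) ^ D.card := by
      rw [← Real.exp_nat_mul, Real.exp_le_exp]
      nlinarith [hcount, hε₁]
    have hreal : (γ A σ).real E ≤ (Real.exp (ε₁ * 3 ^ d) * p) ^ D.card := by
      calc (γ A σ).real E ≤ Real.exp (ε₁ * cellCount cell A) * (γ₀ A σ).real E := hac
        _ ≤ Real.exp (ε₁ * 3 ^ d) ^ D.card * p ^ D.card :=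
            mul_le_mul hexp h0 measureReal_nonneg (by positivity)
        _ = (Real.exp (ε₁ * 3 ^ d) * p) ^ D.card := by rw [mul_pow]
    rw [← ofReal_measureReal (measure_ne_top _ _)]
    exact ENNReal.ofReal_le_ofReal hreal
  -- consistency `γ_Λ = γ_Λ γ_A` and properness
  haveI := hγ.isProbability Λ ζ
  rw [← hγ.consistent hAΛ ζ E hE]
  calc ∫⁻ σ, γ A σ E ∂(γ Λ ζ)
      ≤ ∫⁻ _σ, ENNReal.ofReal ((Real.exp (ε₁ * 3 ^ d) * p) ^ D.card) ∂(γ Λ ζ) := by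
        refine lintegral_mono_ae ?_
        filter_upwards [hγ.proper Λ ζ] with σ hσ
        exact hpt σ hσ
    _ = ENNReal.ofReal ((Real.exp (ε₁ * 3 ^ d) * p) ^ D.card) := by
        rw [lintegral_const, measure_univ, mul_one]

/-- **Peierls transfer to the perturbed Gibbs measures.** Under the hypotheses of
`kernel_allBad_le_of_uniformKernelPeierls`, on a finite site set every Gibbs measure `ν` of `γ`
has Peierls-rare bad cells at level `e^{3^d ε₁} p` (`ν = γ_univ(· | ζ)`, `gibbs_eq_kernel_univ`,
and every cell is a cell of `univ`). [folklore] -/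
theorem peierlsRare_of_uniformKernelPeierls [Fintype V] {cell : V → CoarseIdx μc}
    {γ γ₀ : Specification V S} (hγ : IsSpecification γ) {good : CoarseIdx μc → Set (V → S)}
    (hgl : ∀ (c : CoarseIdx μc) (σ τ : V → S), (∀ v, cell v = c → σ v = τ v) →
      (σ ∈ good c ↔ τ ∈ good c))
    (hgm : ∀ c, MeasurableSet (good c)) {p ε₁ : ℝ} (hp : 0 ≤ p) (hε₁ : 0 ≤ ε₁)
    (hUKP : UniformKernelPeierls cell γ₀ good p) (hAC : IsLocallyAC cell γ γ₀ ε₁)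
    {ν : Measure (V → S)} (hν : IsGibbsMeasure γ ν) :
    PeierlsRare good ν (Real.exp (ε₁ * 3 ^ d) * p) := by
  classical
  intro D
  obtain ⟨ζ⟩ : Nonempty (V → S) := by
    haveI := hν.isProbabilityMeasure
    obtain ⟨σ, -⟩ := nonempty_of_measure_ne_zero (μ := ν) (s := Set.univ) (by simp)
    exact ⟨σ⟩
  rw [gibbs_eq_kernel_univ hγ hν ζ]
  exact kernel_allBad_le_of_uniformKernelPeierls hγ hgl hgm hp hε₁ hUKP hAC Finset.univ
    (fun _ _ _ _ => Finset.mem_univ _) ζ D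
    fun c _ c' _ => Or.inl fun v _ => Finset.mem_univ v

end Literature.Probability.LatticeModels
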